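import Summits.Ventures.LatticeQCDFlow.Scaling.EntropicTransportSteps

/-!
# LatticeQCDFlow / Scaling — (C2a-H′) HEATING FLOWS MUST CONTRACT: an exact co-Lipschitz `μ_{Λ,β₀} → μ_{Λ,β}`, `β ≤ β₀`, has `coLip ≥ e^{c(β₀-β)-C}`

HONEST FRAMING: exact (Metropolis-corrected) sampling algorithms for lattice gauge theory; figures of merit are
autocorrelation/cost numbers at stated couplings and volumes; no continuum-physics claim.

Venture `LatticeQCDFlow` (cell pub-lqcd), topic `Scaling`, FANOUT row 29 (theory-2) — OUR WORK (THEORY-2.md §3.3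
v2.9, "(C2a-H′) the fourth corner of the transport square").  Between two couplings `β_hot < β_cold` an exact
deterministic transport obeys four one-sided laws, two per direction.  Three are in the tree / in
`Scaling/EntropicTransport.lean`: COOLING (`μ_{β_hot} → μ_{β_cold}`) needs `Lip ≥ e^{c(β_cold-β_hot)-C}`
(`ExactTransportExpansionBetween`, `Scaling/ExactTransportBetween.lean`) and `coLip ≳ (β_cold/β_hot)^{(d-1)/(2d)}`
(`CoolingContractionBetween`); HEATING (`μ_{β_cold} → μ_{β_hot}`) needs `Lip ≳ (β_cold/β_hot)^{(d-1)/(2d)}`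
(`HeatingExpansionBetween`).  This file proves the fourth:

* `HeatingContractionBetween` (C2a-H′): there are `c > 0`, `C`, independent of the volume, such that for every
  `L ≥ 2`, every `0 ≤ β ≤ β₀` and every exact CO-LIPSCHITZ transport `T` of `μ_{Λ,β₀}` onto `μ_{Λ,β}`
  (`dist x y ≤ K'·dist (T x) (T y)`, sup metric on `G^E`; no injectivity, smoothness or Lipschitz bound assumed —
  measurability follows from exactness), `K' ≥ e^{c(β₀-β)-C}`: a map that HEATS the ensemble exactly must bring
  some pair of configurations exponentially close — its modulus of injectivity is `≤ e^{-c(β₀-β)+C}`.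

For an invertible `T` this is the tree's window law applied to `T⁻¹`; the point of the file is that NO
invertibility is needed.  Proof (§1): the pointwise STEP 2′ of `Scaling/EntropicTransportSteps.lean`,
`log Z_{β₀} - log Z_β + β₀·S(x) - β·S(Tx) ≤ #E·(log(A/a) + κ·log K')` at EVERY `x`, evaluated at a MAXIMISER
`x_M` of the action (compactness; `S(T x_M) ≤ S(x_M)`, so the left side is `≥ log Z_{β₀} - log Z_β +
(β₀-β)·S_max`), combined with the `Z`-ratio bound `log Z_{β₀} - log Z_β ≥ -(β₀-β)·s₀L^d/4 + #E·(log a + κ·log r₀)`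
(`log_partitionFunction_sub_ge`, low action on a Haar ball around `1`) and the staircase witness `S_max ≥ s₀·L^d`
(`extensive_action_of_nonconstant`): `(β₀-β)·(3s₀/4)·L^d - #E·C₁ ≤ κ·#E·log K'` with `#E = d·L^d` — the `L^d`
cancel, `c = 3s₀/(4κd)`, `C = C₁/κ`, the same constants as the window law.  No image-point or `η → 0` argument is
needed on this side: the maximiser itself is the test point.

Corollaries (§2): the layer-depth form `LayerContractionDepthHeating` (a stack of `Λ'`-co-Lipschitz layers
realising a heating flow exactly has `depth·log Λ' ≥ c(β₀-β) - C`, by `antilipschitzWith_compLayers`), and the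
TRIVIALIZING-MAP form `TrivializingMapContraction` (`β = 0`: every exact trivializing map `T_* μ_{Λ,β} =
Haar^{⊗E}`, invertible or not, has `coLip(T) ≥ e^{cβ-C}`).  Instances with NO hypothesis left (§3): `U(1)`,
`U(N)` (`N ≥ 1`), `SU(N)` (`N ≥ 2`; `SU(3)`, `d = 4` included), `d ≥ 2`, exactly as for the window law.
Reading (THEORY-2 §5.11 supplement 6, "the transport square"): the EXPONENTIAL obstruction `e^{c|β-β₀|}` sits on
the side that must populate the rare high-action configurations of the hotter measure from the colder one — the
Lipschitz side when cooling, the co-Lipschitz side when heating (this file); the other two sides are power laws.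
Elementary given the tree; nothing here is cited as a fact.  References for the reading: Lüscher, Commun. Math.
Phys. 293 (2010) 899, arXiv:0907.5491 (trivializing maps); Abbott et al. arXiv:2211.07541 §IV–V; Bulgarelli–
Cellini–Nada arXiv:2412.00200 (flows between couplings, 4-d `SU(3)`); Behrmann et al., "Understanding and
mitigating exploding inverses in invertible neural networks", AISTATS 2021, arXiv:2006.09347 (bi-Lipschitz control
of flows).
-/

noncomputable section

namespace Summit.Ventures.LatticeQCDFlow.Theory2.Lattice

open MeasureTheory Metric Set Literature.MathematicalPhysics.QuantumFieldTheory

/-! ## §0. The items -/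

section Defs

variable (d N : ℕ) (G : Type) [Group G] [MetricSpace G] [IsTopologicalGroup G] [CompactSpace G]
  [MeasurableSpace G] [BorelSpace G] (ρ : G →* Matrix (Fin N) (Fin N) ℂ)

/-- **(C2a-H′) THE CONTRACTION LAW FOR HEATING FLOWS** (OURS, THEORY-2.md §3.3 v2.9): there are `c > 0`, `C` such
that for every `L ≥ 2`, every `0 ≤ β ≤ β₀` and every exact CO-LIPSCHITZ transport `T` of `μ_{Λ,β₀}` onto `μ_{Λ,β}`
(`AntilipschitzWith K' T`, sup metric on `G^E`), `K' ≥ e^{c(β₀-β)-C}` — uniformly in the volume.  Proved for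
two-sided ball volumes and a non-constant character (§1) and unconditionally for `U(1)`, `U(N)`, `SU(N)` (§3).
[folklore] -/
@[conjecture]
def HeatingContractionBetween : Prop :=
  ∃ c : ℝ, 0 < c ∧ ∃ C : ℝ, ∀ (L : ℕ) [NeZero L], 2 ≤ L → ∀ β₀ β : ℝ, 0 ≤ β → β ≤ β₀ →
    ∀ (T : GaugeConfig d L G → GaugeConfig d L G) (K' : NNReal), AntilipschitzWith K' T →
      (wilsonMeasure (d := d) (L := L) ρ β₀).map T = wilsonMeasure (d := d) (L := L) ρ β →
      Real.exp (c * (β₀ - β) - C) ≤ (K' : ℝ)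

/-- **(C2a-H′-depth) LAYER-DEPTH FORM** (OURS): there are `c > 0`, `C` such that for every `L ≥ 2`, every
`0 ≤ β ≤ β₀` and every stack of layers, each `Λ'`-co-Lipschitz for the sup metric, whose composite transports
`μ_{Λ,β₀}` EXACTLY onto `μ_{Λ,β}`: `depth · log Λ' ≥ c(β₀-β) - C`. [folklore] -/
@[conjecture]
def LayerContractionDepthHeating : Prop :=
  ∃ c : ℝ, 0 < c ∧ ∃ C : ℝ, ∀ (L : ℕ) [NeZero L], 2 ≤ L → ∀ β₀ β : ℝ, 0 ≤ β → β ≤ β₀ →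
    ∀ (l : List (GaugeConfig d L G → GaugeConfig d L G)) (Λ' : NNReal), (∀ T ∈ l, AntilipschitzWith Λ' T) →
      (wilsonMeasure (d := d) (L := L) ρ β₀).map (compLayers l) = wilsonMeasure (d := d) (L := L) ρ β →
      c * (β₀ - β) - C ≤ (l.length : ℝ) * Real.log (Λ' : ℝ)

/-- **(C2a-H′-triv) THE TRIVIALIZING-MAP FORM** (OURS): there are `c > 0`, `C` such that for every `L ≥ 2`, every
`β ≥ 0` and every exact TRIVIALIZING map `T` — `T_* μ_{Λ,β} = Haar^{⊗E}`, invertible or not — that is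
`K'`-co-Lipschitz for the sup metric, `K' ≥ e^{cβ-C}`: an exact trivialization must contract some pair of
configurations by `e^{-cβ+C}`, uniformly in the volume. [folklore] -/
@[conjecture]
def TrivializingMapContraction : Prop :=
  ∃ c : ℝ, 0 < c ∧ ∃ C : ℝ, ∀ (L : ℕ) [NeZero L], 2 ≤ L → ∀ β : ℝ, 0 ≤ β →
    ∀ (T : GaugeConfig d L G → GaugeConfig d L G) (K' : NNReal), AntilipschitzWith K' T →
      (wilsonMeasure (d := d) (L := L) ρ β).map T = (Measure.pi fun _ : Edge d L => haarProbability G) →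
      Real.exp (c * β - C) ≤ (K' : ℝ)

end Defs

/-! ## §1. The law from two-sided ball volumes and a non-constant character -/

section Law

variable {N : ℕ} {G : Type} [Group G] [MetricSpace G] [IsTopologicalGroup G] [CompactSpace G]
  [SecondCountableTopology G] [MeasurableSpace G] [BorelSpace G]
  (ρ : G →* Matrix (Fin N) (Fin N) ℂ)

/-- **(C2a-H′) PROVED from ball volumes** (OURS): two-sided Haar ball volumes `a·r^κ ≤ Haar(B̄(g,r)) ≤ A·r^κ`
(`r ≤ 1` for the lower bound) with `κ ≥ 1`, a continuous `ρ` with `Re tr ρ ≤ N` and some `Re tr ρ(g) ≠ N`,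
`d ≥ 2` ⟹ `HeatingContractionBetween d N G ρ` with `c = 3s₀/(4κd)`, `C = (log(A/a) - log a - κ·log r₀)/κ`
(`s₀` the staircase constant, `r₀` the uniform low-action radius) — the constants of the window law.  STEP 2′ at
an action maximiser plus the `Z`-ratio bound; the `L^d` cancel. [folklore] -/
theorem heatingContractionBetween_of_ballVolumes (d : ℕ) (hd : 2 ≤ d)
    (hρ : Continuous (ρ : G → Matrix (Fin N) (Fin N) ℂ))
    (htr : ∀ g, (ρ g).trace.re ≤ N) (hnc : ∃ g : G, (ρ g).trace.re ≠ N)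
    {κ : ℕ} (hκ : 0 < κ) {a A : ℝ} (ha : 0 < a)
    (hlo : ∀ (g : G) (r : ℝ), 0 < r → r ≤ 1 → a * r ^ κ ≤ (haarProbability G (closedBall g r)).toReal)
    (hup : ∀ (g : G) (r : ℝ), 0 < r → (haarProbability G (closedBall g r)).toReal ≤ A * r ^ κ) :
    HeatingContractionBetween d N G ρ := by
  obtain ⟨s₀, hs₀, hconf⟩ := extensive_action_of_nonconstant (d := d) ρ htr hnc hd
  have haA : a ≤ A := by
    have h1 := hlo 1 1 one_pos le_rfl
    have h2 := hup 1 1 one_pos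
    rw [one_pow, mul_one] at h1 h2
    exact h1.trans h2
  have hA : 0 < A := ha.trans_le haA
  obtain ⟨g₁, hg₁⟩ := exists_ne_one_of_ballVolumes hκ hA hup
  -- the uniform low-action radius
  set m : ℕ := Fintype.card {p : Fin d × Fin d // p.1 < p.2} with hm
  set η : ℝ := s₀ / (4 * ((m : ℝ) + 1)) with hηdef
  have hη : 0 < η := by positivity
  obtain ⟨r₀, hr₀, hr₀1, hball⟩ := exists_radius_action_le ρ hρ hη
  set C₁ : ℝ := Real.log (A / a) - Real.log a - κ * Real.log r₀ with hC₁
  have hκr : (0 : ℝ) < κ := by exact_mod_cast hκ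
  have hdr : (2 : ℝ) ≤ d := by exact_mod_cast hd
  have hd0 : (0 : ℝ) < d := by linarith
  refine ⟨3 * s₀ / (4 * κ * d), by positivity, C₁ / κ, fun L _ hL β₀ β hβ0 hβ T K' hT' hmap => ?_⟩
  have hβ₀ : 0 ≤ β₀ := hβ0.trans hβ
  have hL1 : (1 : ℝ) ≤ L := by exact_mod_cast (NeZero.one_le : 1 ≤ L)
  have hLd0 : (0 : ℝ) < (L : ℝ) ^ d := by positivity
  set S : GaugeConfig d L G → ℝ := wilsonAction (d := d) (L := L) ρ with hSdef
  have hScont : Continuous S := continuous_wilsonAction (d := d) (L := L) ρ hρ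
  -- cardinalities
  have hEn : Fintype.card (Edge d L) = L ^ d * d := by simp [Fintype.card_prod, ZMod.card, Fintype.card_fin]
  have hE : (Fintype.card (Edge d L) : ℝ) = d * (L : ℝ) ^ d := by rw [hEn]; push_cast; ring
  have hPn : Fintype.card (Plaquette d L) = L ^ d * m := by
    rw [hm]; simp [Fintype.card_prod, ZMod.card, Fintype.card_fin]
  have hP : (Fintype.card (Plaquette d L) : ℝ) = (L : ℝ) ^ d * m := by rw [hPn]; push_cast; ring
  -- low action on `B̄(1, r₀)`
  have hlow : ∀ U : GaugeConfig d L G, dist U 1 ≤ r₀ → S U ≤ s₀ * (L : ℝ) ^ d / 4 := by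
    intro U hU
    have h := hball d L U hU
    rw [hP] at h
    calc S U ≤ η * ((L : ℝ) ^ d * m) := h
      _ ≤ η * ((L : ℝ) ^ d * (m + 1)) := by gcongr; linarith
      _ = s₀ * (L : ℝ) ^ d / 4 := by rw [hηdef]; field_simp
  -- the `Z`-ratio (heating lowers `-log Z` by at most the low-action ball):
  -- `log Z_{β₀} - log Z_β ≥ -(β₀-β)s₀L^d/4 + #E(log a + κ log r₀)`
  have hlogZ := log_partitionFunction_sub_ge ρ hρ htr hβ0 hβ ha hlo hr₀ hr₀1 hlow
  -- the maximum of the action, `≥ s₀L^d`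
  obtain ⟨xM, -, hxM⟩ :=
    isCompact_univ.exists_isMaxOn univ_nonempty (hScont.continuousOn (s := (univ : Set (GaugeConfig d L G))))
  have hSmax : ∀ U, S U ≤ S xM := fun U => (isMaxOn_iff.1 hxM) U (mem_univ U)
  obtain ⟨Vhi, hVhi⟩ := hconf L hL
  have hSM : s₀ * (L : ℝ) ^ d ≤ S xM := le_trans hVhi (hSmax Vhi)
  -- `K' > 0`: two distinct configurations
  have hK'0 : 0 < (K' : ℝ) := by
    set e₀ : Edge d L := (fun _ => 0, ⟨0, by omega⟩) with he₀
    have hne : (fun _ : Edge d L => g₁) ≠ (1 : GaugeConfig d L G) := fun h => hg₁ (by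
      have := congr_fun h e₀
      simpa using this)
    have h1 := hT'.le_mul_dist (fun _ : Edge d L => g₁) 1
    have hpos : 0 < dist (fun _ : Edge d L => g₁) (1 : GaugeConfig d L G) := dist_pos.2 hne
    rcases K'.coe_nonneg.eq_or_lt with h | h
    · rw [← h, zero_mul] at h1; linarith
    · exact h
  -- STEP 2′ at the maximiser: no image-point argument is needed on this side
  have h2 := neg_log_partitionFunction_sub_le_between ρ hρ htr ha hA hlo hup hβ₀ hβ0 hK'0 hT' hmap xM
  have hp1 : β * S (T xM) ≤ β * S xM := mul_le_mul_of_nonneg_left (hSmax _) hβ0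
  have hp3 : (β₀ - β) * (s₀ * (L : ℝ) ^ d) ≤ (β₀ - β) * S xM :=
    mul_le_mul_of_nonneg_left hSM (sub_nonneg.2 hβ)
  have hmain : (β₀ - β) * (3 * (s₀ * (L : ℝ) ^ d) / 4) - Fintype.card (Edge d L) * C₁ ≤
      κ * Fintype.card (Edge d L) * Real.log K' := by
    rw [hC₁]
    have h2' : Real.log (partitionFunction (d := d) (L := L) ρ β₀).toReal -
        Real.log (partitionFunction (d := d) (L := L) ρ β).toReal + β₀ * S xM - β * S (T xM) ≤
        Fintype.card (Edge d L) * (Real.log (A / a) + κ * Real.log K') := h2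
    linarith [h2', hlogZ, hp1, hp3]
  rw [hE] at hmain
  have hmain' : (β₀ - β) * (3 * s₀ / 4) - d * C₁ ≤ κ * d * Real.log K' := by
    refine le_of_not_gt fun hcon => ?_
    have := mul_lt_mul_of_pos_left hcon hLd0
    linarith
  have hkd : (0 : ℝ) < κ * d := by positivity
  have key : 3 * s₀ / (4 * κ * d) * (β₀ - β) - C₁ / κ ≤ Real.log K' := by
    have : 3 * s₀ / (4 * κ * d) * (β₀ - β) - C₁ / κ = ((β₀ - β) * (3 * s₀ / 4) - d * C₁) / (κ * d) := by
      field_simp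
    rw [this, div_le_iff₀ hkd]
    linarith
  calc Real.exp (3 * s₀ / (4 * κ * d) * (β₀ - β) - C₁ / κ) ≤ Real.exp (Real.log K') := Real.exp_le_exp.2 key
    _ = K' := Real.exp_log hK'0

end Law

/-! ## §2. Corollaries: the layer-depth form and the trivializing-map form -/

section Corollaries

variable {N : ℕ} {G : Type} [Group G] [MetricSpace G] [IsTopologicalGroup G] [CompactSpace G]
  [MeasurableSpace G] [BorelSpace G] (ρ : G →* Matrix (Fin N) (Fin N) ℂ)

/-- **(C2a-H′) ⟹ its layer-depth form** (same `c`, `C`): apply the law to the composite of the stack, whose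
co-Lipschitz constant is `Λ'^depth` (`antilipschitzWith_compLayers`), and take logarithms. [folklore] -/
theorem layerContractionDepthHeating_of_heating {d : ℕ} (h : HeatingContractionBetween d N G ρ) :
    LayerContractionDepthHeating d N G ρ := by
  obtain ⟨c, hc, C, hC⟩ := h
  refine ⟨c, hc, C, fun L _ hL β₀ β hβ0 hβ l Λ' hΛ' hmap => ?_⟩
  have h1 := hC L hL β₀ β hβ0 hβ (compLayers l) (Λ' ^ l.length) (antilipschitzWith_compLayers l hΛ') hmap
  rw [NNReal.coe_pow] at h1
  have h2 := Real.log_le_log (Real.exp_pos _) h1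
  rwa [Real.log_exp, Real.log_pow] at h2

/-- **(C2a-H′) ⟹ the trivializing-map form** (same `c`, `C`): at `β = 0` the Wilson weight is `1` and
`Z_Λ(0) = 1`, so `μ_{Λ,0}` is the product Haar measure. [folklore] -/
theorem trivializingMapContraction_of_heating {d : ℕ} (h : HeatingContractionBetween d N G ρ) :
    TrivializingMapContraction d N G ρ := by
  obtain ⟨c, hc, C, hC⟩ := h
  refine ⟨c, hc, C, fun L _ hL β hβ T K' hT' hmap => ?_⟩
  have h0 : wilsonMeasure (d := d) (L := L) ρ 0 = Measure.pi fun _ : Edge d L => haarProbability G := by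
    have hW : wilsonWeight (d := d) (L := L) ρ 0 = Measure.pi fun _ : Edge d L => haarProbability G := by
      unfold wilsonWeight
      rw [show (fun U : GaugeConfig d L G => ENNReal.ofReal (Real.exp (-0 * wilsonAction ρ U))) = 1 from
        funext fun U => by simp, withDensity_one]
    unfold wilsonMeasure partitionFunction
    rw [hW, measure_univ, inv_one, one_smul]
  have h1 := hC L hL β 0 le_rfl hβ T K' hT' (by rw [h0]; exact hmap)
  simpa only [sub_zero] using h1

end Corollaries

/-! ## §3. Instances with no hypothesis left: `U(1)`, `U(N)`, `SU(N)` -/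

section Instances

open scoped Matrix.Norms.Frobenius
open Literature.MathematicalPhysics.QuantumFieldTheory.UnitaryCayley (𝔾)
open Literature.MathematicalPhysics.QuantumLattice (u1Rep continuous_u1Rep unitaryFundamentalRep
  continuous_unitaryFundamentalRep fundamentalRep continuous_fundamentalRep)

/-- **(C2a-H′) for `U(1) = Circle`, `d ≥ 2`** (OURS): `coLip(T) ≥ e^{c(β₀-β)-C}` for every exact co-Lipschitz
transport of the `U(1)` Wilson law at `β₀` onto the one at `β ≤ β₀` (`β ≥ 0`), `L ≥ 2`, uniformly in `L`.
[folklore] -/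
theorem U1.heatingContractionBetween (d : ℕ) (hd : 2 ≤ d) :
    HeatingContractionBetween d 1 Circle u1Rep := by
  obtain ⟨a, ha, hlo⟩ := U1.haar_closedBall_ge'
  obtain ⟨A, _, hup⟩ := U1.haar_closedBall_le'
  exact heatingContractionBetween_of_ballVolumes u1Rep d hd continuous_u1Rep U1.re_trace_u1Rep_le
    ⟨Circle.exp Real.pi, by rw [U1.re_trace_exp_pi]; norm_num⟩ one_pos ha hlo hup

/-- **(C2a-H′) for `U(N)`, `N ≥ 1`, `d ≥ 2`, Hilbert–Schmidt metric** (OURS). [folklore] -/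
theorem UN.heatingContractionBetween (d N : ℕ) (hd : 2 ≤ d) (hN : 1 ≤ N) :
    @HeatingContractionBetween d N (𝔾 N) _ Subtype.metricSpace UN.isTopologicalGroup_hs UN.compactSpace_hs _
      UN.borelSpace_hs (unitaryFundamentalRep (Fin N) ℂ) := by
  obtain ⟨a, ha, hlo⟩ := UN.haar_closedBall_ge (N := N)
  obtain ⟨A, hA, hup⟩ := UN.haar_closedBall_le (N := N)
  have hκ : 0 < N * N := Nat.mul_pos (by omega) (by omega)
  have hnc : ∃ g : 𝔾 N, (unitaryFundamentalRep (Fin N) ℂ g).trace.re ≠ N := ⟨-1, by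
    rw [UN.re_trace_neg_one]
    have : (1 : ℝ) ≤ N := by exact_mod_cast hN
    linarith⟩
  exact @heatingContractionBetween_of_ballVolumes N (𝔾 N) _ Subtype.metricSpace UN.isTopologicalGroup_hs
    UN.compactSpace_hs UN.secondCountable_hs _ UN.borelSpace_hs (unitaryFundamentalRep (Fin N) ℂ) d hd
    (continuous_unitaryFundamentalRep (Fin N) ℂ) UN.re_trace_le hnc (N * N) hκ a A ha hlo
    (fun g r hr => hup g r hr)

/-- **(C2a-H′) for `SU(N)`, `N ≥ 2`, `d ≥ 2`, Hilbert–Schmidt metric** (OURS; `SU(3)`, `d = 4` included: an exact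
co-Lipschitz flow `μ_{β₀} → μ_β`, `0 ≤ β ≤ β₀`, has `log coLip(T) ≥ c(β₀-β) - C` with `c, C` independent of the
volume). [folklore] -/
theorem SUN.heatingContractionBetween (d N : ℕ) (hd : 2 ≤ d) (hN : 2 ≤ N) :
    @HeatingContractionBetween d N (Matrix.specialUnitaryGroup (Fin N) ℂ) _ Subtype.metricSpace
      SUN.isTopologicalGroup_hs SUN.compactSpace_hs _ SUN.borelSpace_hs (fundamentalRep (Fin N)) := by
  haveI : NeZero N := ⟨by omega⟩
  obtain ⟨a, ha, hlo⟩ := SUN.haar_closedBall_ge (N := N)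
  obtain ⟨A, hA, hup⟩ := SUN.haar_closedBall_le (N := N)
  have hκ : 0 < N * N - 1 := by
    have : 2 * 2 ≤ N * N := Nat.mul_le_mul hN hN
    omega
  have hnc : ∃ g : Matrix.specialUnitaryGroup (Fin N) ℂ, (fundamentalRep (Fin N) g).trace.re ≠ N := by
    by_contra h
    simp only [not_exists, ne_eq, not_not] at h
    obtain ⟨V, hV⟩ := SUN.exists_action_ge hN hd 1
    have hS : wilsonAction (fundamentalRep (Fin N)) V = 0 := by
      unfold wilsonAction
      exact Finset.sum_eq_zero fun p _ => by rw [h, sub_self]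
    rw [hS] at hV
    norm_num at hV
  exact @heatingContractionBetween_of_ballVolumes N (Matrix.specialUnitaryGroup (Fin N) ℂ) _
    Subtype.metricSpace SUN.isTopologicalGroup_hs SUN.compactSpace_hs SUN.secondCountable_hs _ SUN.borelSpace_hs
    (fundamentalRep (Fin N)) d hd (continuous_fundamentalRep (Fin N)) (SUN.re_trace_le N) hnc
    (N * N - 1) hκ a A ha hlo (fun g r hr => hup g r hr)

/-- **(C2a-H′-depth) for `SU(N)`, `N ≥ 2`, `d ≥ 2`** (OURS; `SU(3)`, `d = 4` included): a stack of
`Λ'`-co-Lipschitz layers realising a heating flow `μ_{β₀} → μ_β` (`0 ≤ β ≤ β₀`) exactly has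
`depth·log Λ' ≥ c(β₀-β) - C`. [folklore] -/
theorem SUN.layerContractionDepthHeating (d N : ℕ) (hd : 2 ≤ d) (hN : 2 ≤ N) :
    @LayerContractionDepthHeating d N (Matrix.specialUnitaryGroup (Fin N) ℂ) _ Subtype.metricSpace
      SUN.isTopologicalGroup_hs SUN.compactSpace_hs _ SUN.borelSpace_hs (fundamentalRep (Fin N)) :=
  @layerContractionDepthHeating_of_heating N (Matrix.specialUnitaryGroup (Fin N) ℂ) _ Subtype.metricSpace
    SUN.isTopologicalGroup_hs SUN.compactSpace_hs _ SUN.borelSpace_hs (fundamentalRep (Fin N)) d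
    (SUN.heatingContractionBetween d N hd hN)

/-- **(C2a-H′-triv) for `SU(N)`, `N ≥ 2`, `d ≥ 2`** (OURS; `SU(3)`, `d = 4` included): every exact trivializing
map of the `SU(N)` Wilson law at `β ≥ 0` — `T_* μ_{Λ,β} = Haar^{⊗E}`, invertible or not — that is
`K'`-co-Lipschitz for the Hilbert–Schmidt sup metric has `K' ≥ e^{cβ-C}`, `c, C` independent of the volume.
[folklore] -/
theorem SUN.trivializingMapContraction (d N : ℕ) (hd : 2 ≤ d) (hN : 2 ≤ N) :
    @TrivializingMapContraction d N (Matrix.specialUnitaryGroup (Fin N) ℂ) _ Subtype.metricSpace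
      SUN.isTopologicalGroup_hs SUN.compactSpace_hs _ SUN.borelSpace_hs (fundamentalRep (Fin N)) :=
  @trivializingMapContraction_of_heating N (Matrix.specialUnitaryGroup (Fin N) ℂ) _ Subtype.metricSpace
    SUN.isTopologicalGroup_hs SUN.compactSpace_hs _ SUN.borelSpace_hs (fundamentalRep (Fin N)) d
    (SUN.heatingContractionBetween d N hd hN)

end Instances

end Summit.Ventures.LatticeQCDFlow.Theory2.Lattice
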